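import Summits.QuantumFields.YangMills.Theorems.ColdStartUniversalityLatticeLangevinDynkin
import Summits.QuantumFields.YangMills.Theorems.ColdStartUniversalityColdStartSolutionsExistFlatFiltration
import HarnessLib

/-!
# Route `ColdStartUniversality`, rung `stub_fixedCutoffMixing` of K_A1 (stmt-QuantumFields-24809):
# Dynkin's formula in expectation — flat-noise form

Helper file (seat `ym-line-csu-p1`, g6): the Dynkin / Itô formula in conditional expectation
`dynkin_expectation` restated for processes driven by the coordinates of a FLAT Brownian motion
`W : ℝ≥0 → Ω → (Edge d L × κ → ℝ)` (`IsFlatBrownian`, the noise of the lattice Langevin dynamics)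
and adapted to `hW.natFiltration` (`dynkin_expectation_flat`): the flat filtration is the joint
filtration of the enumerated Brownian vector (`natFiltration_flat_eq`).  No definition, no sorry,
standard axioms.  RECORD-rung plumbing (R3); the Yang–Mills mass gap is NOT proved.
-/

set_option autoImplicit false

noncomputable section

namespace Summit.QuantumFields.YangMills.Theorems.ColdStartUniversality

open MeasureTheory ProbabilityTheory Filter Finset
open scoped NNReal ENNReal Topology
open Literature.Probability.Process Literature.MathematicalPhysics.QuantumFieldTheory

section Flat

variable {Ω : Type*} {mΩ : MeasurableSpace Ω} {P : Measure Ω} [IsProbabilityMeasure P] {d L : ℕ}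
  [NeZero L] {κ : Type} [Fintype κ] {W : ℝ≥0 → Ω → (Edge d L × κ → ℝ)} {ι : Type} [Fintype ι]
  {X : ℝ≥0 → Ω → (ι → ℝ)} {b : ι → ℝ≥0 → Ω → ℝ}
  {σ J : ι → Edge d L × κ → ℝ≥0 → Ω → ℝ} {M : ℝ}
  {f : (ι → ℝ) → ℝ} {g : ι → (ι → ℝ) → ℝ} {h : ι → ι → (ι → ℝ) → ℝ} {Cf : ℝ}
  {s t : ℝ≥0} {Z : Ω → ℝ} {C : ℝ}

/-- **Dynkin's formula in (conditional) expectation, flat-noise form**: for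
`X_t^i = X_0^i + ∫₀ᵗ bⁱ dr + ∑_n ∫₀ᵗ σ^{i,n} dW^n` driven by the coordinates `n ∈ Edge d L × κ` of a
flat Brownian motion (bounded progressive coefficients, `hW.natFiltration`), second-order Taylor
data `(f, g, h, Cf)`, `s ≤ t` and bounded `𝓕_s`-measurable `Z`:
`E[Z (f(X_t) - f(X_s))] = E[Z ∫_{(s,t]} (∑ᵢ gᵢ(X_r) bⁱ_r + ½ ∑ᵢⱼ hᵢⱼ(X_r) ∑_n σ^{i,n}_r σ^{j,n}_r) dr]`.
[folklore] -/
theorem dynkin_expectation_flat (hW : IsFlatBrownian W P)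
    (hb : ∀ i, IsStronglyProgressive hW.natFiltration (b i))
    (hσ : ∀ i n, IsStronglyProgressive hW.natFiltration (σ i n))
    (hbM : ∀ i r ω, |b i r ω| ≤ M) (hσM : ∀ i n r ω, |σ i n r ω| ≤ M)
    (hJ : ∀ i n, IsItoIntegral (σ i n) (fun r ω => W r ω n) (J i n) hW.natFiltration P)
    (hXm : ∀ i, Measurable fun p : Ω × ℝ ↦ X p.2.toNNReal p.1 i)
    (hXa : ∀ i t, StronglyMeasurable[hW.natFiltration t] (fun ω ↦ X t ω i))
    (hXeq : ∀ i, ∀ᵐ ω ∂P, ∀ t, X t ω i = X 0 ω i + (∫ r in (0 : ℝ)..t, b i r.toNNReal ω) + ∑ n, J i n t ω)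
    (hfc : Continuous f) (hgc : ∀ i, Continuous (g i)) (hhc : ∀ i j, Continuous (h i j))
    (hfB : ∀ y, |f y| ≤ Cf) (hgB : ∀ i y, |g i y| ≤ Cf) (hhB : ∀ i j y, |h i j y| ≤ Cf)
    (hgL : ∀ i y y', |g i y - g i y'| ≤ Cf * ∑ l, |y l - y' l|)
    (hhL : ∀ i j y y', |h i j y - h i j y'| ≤ Cf * ∑ l, |y l - y' l|)
    (hT : ∀ y Δ : ι → ℝ, |f (y + Δ) - f y - ∑ i, g i y * Δ i - (1 / 2) * ∑ i, ∑ j, h i j y * (Δ i * Δ j)|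
      ≤ Cf * ∑ i, |Δ i| ^ 3)
    (hst : s ≤ t) (hZ : StronglyMeasurable[hW.natFiltration s] Z) (hC : ∀ ω, |Z ω| ≤ C) :
    ∫ ω, Z ω * (f (X t ω) - f (X s ω)) ∂P =
      ∫ ω, Z ω * (∫ r in Set.Ioc (s : ℝ) t, (∑ i, g i (X r.toNNReal ω) * b i r.toNNReal ω +
        (1 / 2) * ∑ i, ∑ j, h i j (X r.toNNReal ω) * ∑ n, σ i n r.toNNReal ω * σ j n r.toNNReal ω)) ∂P := by
  classical
  -- enumerate the noise index
  set e := Fintype.equivFin (Edge d L × κ) with he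
  have hF := natFiltration_flat_eq hW
  have hb' : ∀ i, IsStronglyProgressive (IsBrownianVec.natFiltration hW) (b i) := fun i ↦ hF ▸ hb i
  have hσ' : ∀ i (k : Fin (Fintype.card (Edge d L × κ))),
      IsStronglyProgressive (IsBrownianVec.natFiltration hW) (σ i (e.symm k)) := fun i k ↦ hF ▸ hσ i (e.symm k)
  have hJ' : ∀ i (k : Fin (Fintype.card (Edge d L × κ))),
      IsItoIntegral (σ i (e.symm k)) (fun r ω => W r ω (e.symm k)) (J i (e.symm k))
        (IsBrownianVec.natFiltration hW) P := fun i k ↦ hF ▸ hJ i (e.symm k)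
  have hXa' : ∀ i (t : ℝ≥0), StronglyMeasurable[IsBrownianVec.natFiltration hW t] (fun ω ↦ X t ω i) :=
    fun i t ↦ hF ▸ hXa i t
  have hZ' : StronglyMeasurable[IsBrownianVec.natFiltration hW s] Z := hF ▸ hZ
  have hXeq' : ∀ i, ∀ᵐ ω ∂P, ∀ t, X t ω i = X 0 ω i + (∫ r in (0 : ℝ)..t, b i r.toNNReal ω) +
      ∑ k : Fin (Fintype.card (Edge d L × κ)), J i (e.symm k) t ω := by
    intro i
    filter_upwards [hXeq i] with ω hω t
    rw [hω t, ← e.symm.sum_comp (fun n ↦ J i n t ω)]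
  have hD := dynkin_expectation (P := P) (ι := ι) (X := X) (b := b) (M := M) (f := f) (g := g) (h := h)
    (Cf := Cf) (Z := Z) (C := C) (σ := fun i k ↦ σ i (e.symm k)) (J := fun i k ↦ J i (e.symm k)) hW
    hb' hσ' hbM (fun i k ↦ hσM i (e.symm k)) hJ' hXm hXa' hXeq' hfc hgc hhc hfB hgB hhB hgL hhL hT hst hZ' hC
  rw [hD]
  have hpt : ∀ ω, (∫ r in Set.Ioc (s : ℝ) t, (∑ i, g i (X r.toNNReal ω) * b i r.toNNReal ω +
        (1 / 2) * ∑ i, ∑ j, h i j (X r.toNNReal ω) *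
          ∑ k : Fin (Fintype.card (Edge d L × κ)), σ i (e.symm k) r.toNNReal ω * σ j (e.symm k) r.toNNReal ω)) =
      ∫ r in Set.Ioc (s : ℝ) t, (∑ i, g i (X r.toNNReal ω) * b i r.toNNReal ω +
        (1 / 2) * ∑ i, ∑ j, h i j (X r.toNNReal ω) * ∑ n, σ i n r.toNNReal ω * σ j n r.toNNReal ω) := by
    intro ω
    refine setIntegral_congr_fun measurableSet_Ioc fun r _ ↦ ?_
    have hs : (∑ i, ∑ j, h i j (X r.toNNReal ω) *
        ∑ k : Fin (Fintype.card (Edge d L × κ)), σ i (e.symm k) r.toNNReal ω * σ j (e.symm k) r.toNNReal ω) =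
        ∑ i, ∑ j, h i j (X r.toNNReal ω) * ∑ n, σ i n r.toNNReal ω * σ j n r.toNNReal ω :=
      sum_congr rfl fun i _ ↦ sum_congr rfl fun j _ ↦ by
        rw [e.symm.sum_comp (fun n ↦ σ i n r.toNNReal ω * σ j n r.toNNReal ω)]
    simp only [hs]
  exact integral_congr_ae (ae_of_all _ fun ω ↦ by simp only [hpt ω])

end Flat

end Summit.QuantumFields.YangMills.Theorems.ColdStartUniversality

end
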